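import Literature.NumberTheory.Automorphic.BaseChangeArchimedean
import Literature.NumberTheory.Automorphic.BaseChangeArchimedeanDescent
import HarnessLib

/-!
# Arthur–Clozel strong lifting, archimedean clause: the degenerate rank `n = 0`;
# regular algebraicity ascends, weight zero ascends and descends

Topic `Literature/NumberTheory/Automorphic`; proofs file (theorems only: no definition, no named
fact) next to `BaseChangeArchimedean`, whose named fact
`ArthurClozel1989_strongLifting_archimedean` (Arthur–Clozel 1989, Ch. 3 Thm. 5.1 with Ch. 1 §7:
the Harish-Chandra parameter of a weak base change lift `Π` at `τ : E → ℂ` is that of `π` at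
`τ|_F`) quantifies over all ranks `n : ℕ`, the fields, and the tree's cuspidal data
`CuspidalAutomorphicRepData n K _`.

For `n ≥ 1` the fact is the strong lifting theorem itself (twisted trace formula comparison,
local archimedean base change, Jacquet–Shalika), which the tree does not contain. This file
settles only the **degenerate rank `n = 0`**, where `GL_0(𝔸_K)` is the trivial group, the Lie
algebra `𝔤𝔩_0(K_∞)` is zero and `U(𝔤𝔩_0) = ℝ`: every automorphic representation datum on `GL_0`
has archimedean parameter `χ` iff every `χ σ` is empty, so the `n = 0` instance of the fact holds
outright (and, unlike Arthur–Clozel's Thm. 4.2 (b), (d) at `n = 0`, is not refutable). What is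
proved:

* `UniversalEnvelopingAlgebra.exists_eq_algebraMap_of_subsingleton` — for a zero Lie algebra `L`
  (`Subsingleton L`), every element of `U(L)` is a scalar (`UniversalEnvelopingAlgebra.hom_ext`).
* `hasCentralCharacter_of_subsingleton` — any representation of a zero real Lie algebra on a
  complex space has the augmentation character as central character.
* `hasHCParameter_fin_zero` — any `𝔤𝔩_0(𝕜)`-module has Harish-Chandra parameter `τ ↦ ∅`.
* `lieDeriv_eq_zero_of_subsingleton` — Lie derivatives of functions on a trivial group vanish.
* `AutomorphicRepData.hasArchParameter_rank_zero_iff` — for a datum `π` on `GL_0(𝔸_K)`,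
  `π.HasArchParameter χ ↔ ∀ σ, χ σ = 0`.
* `ArthurClozel1989_strongLifting_archimedean.rank_zero` — the `n = 0` instance of the named fact,
  unconditionally (no Galois, cyclicity or weak-lift hypothesis is needed).

**Two more consequences of the fact** (regular algebraicity ascends; weight zero ascends and
descends), complementing the `L`/`C` ascents of the fact file and the `L`/`C`/regular descents of
`BaseChangeArchimedeanDescent` (which discharge the uniqueness of archimedean parameters by the
tree theorem `AutomorphicRepData.hasArchParameter_unique`). Granting the fact
`h : ArthurClozel1989_strongLifting_archimedean`, along a weak base change lift `Π` of `π` in a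
cyclic extension `E/F` of prime degree:

* `….isRegularAlgebraic_baseChange` — `π` regular algebraic ⇒ `Π` regular algebraic (`T ↦ T^E`
  keeps the exponents; Clozel 1990, Déf. 1.8, 3.12);
* `….hasWeightZero_baseChange`, `….hasWeightZero_descent` — `π` has weight zero iff `Π` has
  (descent granted an infinity type of `π`, the printed `exists_hasInfinityType`): the weight-zero
  type is constant in the embedding, so `(T₀^F)^E = T₀^E`, and the `a`-multisets of any infinity
  type of `π` are read off from `Π` (`map_a_eq_of_comp_eq`). Clozel 1990, §3.5.

## References

* J. Arthur, L. Clozel, *Simple Algebras, Base Change, and the Advanced Theory of the Trace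
  Formula*, Ann. of Math. Stud. 120 (1989), Ch. 3, Def. 1.1–1.2 (p. 199), Thm. 5.1 (p. 212);
  Ch. 1 §7 (p. 71–72). [`ArthurClozelAMS120`]
* A. W. Knapp, *Lie Groups Beyond an Introduction*, 2nd ed. (2002), §III.1 (universal enveloping
  algebra), §V.5.
* L. Clozel, *Motifs et formes automorphes*, in: Automorphic forms, Shimura varieties, and
  L-functions I (1990), Déf. 1.8, §3.3, Déf. 3.12, §3.5. [`Clozel1990`]
* K. Buzzard, T. Gee, *The conjectural connections between automorphic representations and
  Galois representations*, LMS Lecture Notes 414 (2014), Def. 3.1.1. [`BuzzardGee2014`]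
-/

-- Mathlib idiom (Mathlib/Algebra/Lie/OfAssociative.lean); needed for Lie algebra maps into rings
attribute [local instance 100] LieRing.ofAssociativeRing

noncomputable section

open scoped NumberField Classical
open NumberField

namespace Literature.NumberTheory.Automorphic

/-! ### The enveloping algebra of a zero Lie algebra -/

/-- For a zero Lie algebra `L` the universal enveloping algebra is the base ring: every
`u ∈ U(L)` is a scalar, namely `ε(u)` for the augmentation `ε = lift 0 : U(L) → R` (both `id` and
`algebraMap ∘ ε` are algebra maps `U(L) → U(L)` vanishing on `ι(L) = 0`, so they agree by
`UniversalEnvelopingAlgebra.hom_ext`). Knapp, *Lie Groups Beyond an Introduction*, §III.1. [folklore] -/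
theorem UniversalEnvelopingAlgebra.exists_eq_algebraMap_of_subsingleton {R : Type*} [CommRing R]
    {L : Type*} [LieRing L] [LieAlgebra R L] [Subsingleton L]
    (u : UniversalEnvelopingAlgebra R L) :
    ∃ r : R, u = algebraMap R (UniversalEnvelopingAlgebra R L) r := by
  let ε : UniversalEnvelopingAlgebra R L →ₐ[R] R :=
    UniversalEnvelopingAlgebra.lift R (0 : L →ₗ⁅R⁆ R)
  have key : AlgHom.id R (UniversalEnvelopingAlgebra R L) =
      (Algebra.ofId R (UniversalEnvelopingAlgebra R L)).comp ε := by
    refine UniversalEnvelopingAlgebra.hom_ext (h := ?_)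
    ext x
    rw [Subsingleton.elim x 0, map_zero, map_zero]
  exact ⟨ε u, AlgHom.congr_fun key u⟩

/-- A representation `ρ` of a zero real Lie algebra `L` on a complex space has a central
character, namely the augmentation `θ₀ = ε|_{Z(L)} : Z(L) = U(L) = ℝ → ℂ` (a scalar `r ∈ U(L)`
acts by `r`). Knapp, §V.5. [folklore] -/
theorem hasCentralCharacter_of_subsingleton {L : Type*} [LieRing L] [LieAlgebra ℝ L]
    [Subsingleton L] {V : Type*} [AddCommGroup V] [Module ℂ V]
    (ρ : L →ₗ⁅ℝ⁆ Module.End ℂ V) :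
    HasCentralCharacter ρ ((Algebra.ofId ℝ ℂ).comp
      ((UniversalEnvelopingAlgebra.lift ℝ (0 : L →ₗ⁅ℝ⁆ ℝ)).comp
        (Subalgebra.center ℝ (UniversalEnvelopingAlgebra ℝ L)).val)) := by
  intro z
  obtain ⟨r, hr⟩ := UniversalEnvelopingAlgebra.exists_eq_algebraMap_of_subsingleton
    (R := ℝ) (z : UniversalEnvelopingAlgebra ℝ L)
  simp only [AlgHom.comp_apply, Subalgebra.coe_val, hr, AlgHom.commutes, Complex.coe_algebraMap]
  refine LinearMap.ext fun v ↦ ?_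
  rw [Module.algebraMap_end_apply, Module.algebraMap_end_apply, Complex.coe_smul]

/-! ### Harish-Chandra parameters of `𝔤𝔩_0(𝕜)`-modules -/

/-- **Every `𝔤𝔩_0(𝕜)`-module has Harish-Chandra parameter `τ ↦ ∅`.** The Lie algebra
`𝔤𝔩_0(𝕜)` is zero, `Z(𝔤) = U(𝔤) = ℝ` acts through the augmentation character, and for every
Harish-Chandra homomorphism `γ` and the (unique, empty) enumeration `l`, `γ(r) = r` is a constant
polynomial with `γ(r)(l) = r`. Knapp, §V.5 (degenerate case). [folklore] -/
theorem hasHCParameter_fin_zero {𝕜 : Type*} [RCLike 𝕜] {V : Type*} [AddCommGroup V] [Module ℂ V]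
    (ρ : Matrix (Fin 0) (Fin 0) 𝕜 →ₗ⁅ℝ⁆ Module.End ℂ V) {χ : (𝕜 →ₐ[ℝ] ℂ) → Multiset ℂ}
    (hχ : ∀ τ, χ τ = 0) : HasHCParameter ρ χ := by
  refine ⟨fun τ ↦ by rw [hχ]; rfl, _, hasCentralCharacter_of_subsingleton ρ, ?_⟩
  intro γ l _ z
  obtain ⟨r, hr⟩ := UniversalEnvelopingAlgebra.exists_eq_algebraMap_of_subsingleton
    (R := ℝ) (z : UniversalEnvelopingAlgebra ℝ (Matrix (Fin 0) (Fin 0) 𝕜))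
  have hz : z = algebraMap ℝ _ r := Subtype.ext (by rw [Subalgebra.coe_algebraMap]; exact hr)
  subst hz
  simp only [AlgHom.commutes, MvPolynomial.algebraMap_apply, MvPolynomial.aeval_C,
    Algebra.algebraMap_self, RingHom.id_apply]

/-! ### Lie derivatives on a trivial group -/

section LieDeriv

variable {A : Type*} [NormedCommRing A] [NormedAlgebra ℝ A] [NormedAlgebra ℚ A] [CompleteSpace A]
  [StarRing A] {N : Type*} [Fintype N] [DecidableEq N] {H : RealMatrixGroup A N}
  {G : Type*} [Group G] (ι : H.carrier →* G)

/-- On a trivial group every Lie derivative vanishes: `t ↦ φ (g · ι (exp tX)) = φ g` is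
constant. Borel–Jacquet 1979, §1.5 (degenerate case). [folklore] -/
theorem lieDeriv_eq_zero_of_subsingleton [Subsingleton G] (X : H.lie) (φ : G → ℂ) :
    lieDeriv ι X φ = 0 := by
  funext g
  have h : (fun t : ℝ ↦ φ (g * ι (H.expMem (t • X)))) = fun _ ↦ φ g :=
    funext fun _ ↦ congrArg φ (Subsingleton.elim _ _)
  simp only [lieDeriv, h, deriv_const, Pi.zero_apply]

end LieDeriv

/-! ### Archimedean parameters of automorphic representation data on `GL_0` -/

namespace AutomorphicRepData

variable {K : Type} [Field K] [NumberField K] {hcpt : isCompact_glFiniteIntegralLevel 0 K}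

/-- The zero map is the Lie algebra action of any automorphic representation datum on
`GL_0(𝔸_K)`: `GL_0(𝔸_K)` is the trivial group, so all Lie derivatives vanish.
Borel–Jacquet 1979, 4.6 (degenerate case). [folklore] -/
theorem hasLieAction_zero_rank_zero (π : AutomorphicRepData (AutomorphyDatum.gl 0 K hcpt)) :
    π.HasLieAction 0 := by
  haveI : Subsingleton (AdelicGroupData.gl 0 K).Adelic :=
    ⟨fun a b ↦ Units.ext (Subsingleton.elim _ _)⟩
  intro X φ
  have h0 : π.lieDerivW X φ = 0 :=
    Subtype.ext (lieDeriv_eq_zero_of_subsingleton (AutomorphyDatum.gl 0 K hcpt).ofArch X φ)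
  rw [h0, map_zero, LieHom.zero_apply, LinearMap.zero_apply]

/-- If a datum on `GL_0(𝔸_K)` has archimedean parameter `χ`, then every `χ σ` is empty (each
complex embedding `σ` is `w.embedding` or its conjugate for the place `w = mk σ`, and the
parameter multisets have `0` elements). Clozel 1990, §3.3 (degenerate case). [folklore] -/
theorem eq_zero_of_hasArchParameter_rank_zero {π : AutomorphicRepData (AutomorphyDatum.gl 0 K hcpt)}
    {χ : (K →+* ℂ) → Multiset ℂ} (h : π.HasArchParameter χ) (σ : K →+* ℂ) : χ σ = 0 := by
  obtain ⟨ρ𝔤, -, hre, hco⟩ := h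
  have hσ := InfinitePlace.mk_eq_iff.mp (InfinitePlace.mk_embedding (InfinitePlace.mk σ))
  rcases InfinitePlace.isReal_or_isComplex (InfinitePlace.mk σ) with hw | hw
  · -- real place: one embedding, `σ = (mk σ).embedding`
    have h1 : Multiset.card (χ (InfinitePlace.mk σ).embedding) = 0 :=
      (hre ⟨InfinitePlace.mk σ, hw⟩).1 (Algebra.ofId ℝ ℂ)
    rw [Multiset.card_eq_zero] at h1
    rcases hσ with hσ | hσ
    · rwa [hσ] at h1
    · rw [InfinitePlace.conjugate_embedding_eq_of_isReal hw] at hσ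
      rwa [hσ] at h1
  · rcases hσ with hσ | hσ
    · -- complex place, `σ = (mk σ).embedding`: the `id`-copy
      have h1 : Multiset.card (χ ((AlgHom.id ℝ ℂ).toRingHom.comp
          (InfinitePlace.mk σ).embedding)) = 0 :=
        (hco ⟨InfinitePlace.mk σ, hw⟩).1 (AlgHom.id ℝ ℂ)
      have hc : (AlgHom.id ℝ ℂ).toRingHom.comp (InfinitePlace.mk σ).embedding =
          (InfinitePlace.mk σ).embedding :=
        RingHom.ext fun _ ↦ rfl
      rw [Multiset.card_eq_zero, hc] at h1
      rwa [hσ] at h1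
    · -- complex place, `σ = conj ∘ (mk σ).embedding`: the `conj`-copy
      have h1 : Multiset.card (χ ((Complex.conjAe : ℂ →ₐ[ℝ] ℂ).toRingHom.comp
          (InfinitePlace.mk σ).embedding)) = 0 :=
        (hco ⟨InfinitePlace.mk σ, hw⟩).1 (Complex.conjAe : ℂ →ₐ[ℝ] ℂ)
      have hc : (Complex.conjAe : ℂ →ₐ[ℝ] ℂ).toRingHom.comp (InfinitePlace.mk σ).embedding =
          ComplexEmbedding.conjugate (InfinitePlace.mk σ).embedding :=
        RingHom.ext fun _ ↦ rfl
      rw [Multiset.card_eq_zero, hc] at h1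
      rwa [hσ] at h1

/-- Conversely, on `GL_0(𝔸_K)` every family of empty multisets is an archimedean parameter of
every datum (zero Lie action, `hasHCParameter_fin_zero` place by place).
Clozel 1990, §3.3 (degenerate case). [folklore] -/
theorem hasArchParameter_rank_zero (π : AutomorphicRepData (AutomorphyDatum.gl 0 K hcpt))
    {χ : (K →+* ℂ) → Multiset ℂ} (hχ : ∀ σ, χ σ = 0) : π.HasArchParameter χ :=
  ⟨0, π.hasLieAction_zero_rank_zero, fun _ ↦ hasHCParameter_fin_zero _ fun _ ↦ hχ _,
    fun _ ↦ hasHCParameter_fin_zero _ fun _ ↦ hχ _⟩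

/-- **Archimedean parameters on `GL_0`**: a datum on `GL_0(𝔸_K)` has archimedean parameter `χ`
iff every `χ σ` is empty. Clozel 1990, §3.3 (degenerate case). [folklore] -/
theorem hasArchParameter_rank_zero_iff (π : AutomorphicRepData (AutomorphyDatum.gl 0 K hcpt))
    (χ : (K →+* ℂ) → Multiset ℂ) : π.HasArchParameter χ ↔ ∀ σ, χ σ = 0 :=
  ⟨fun h ↦ eq_zero_of_hasArchParameter_rank_zero h, π.hasArchParameter_rank_zero⟩

end AutomorphicRepData

/-! ### The `n = 0` instance of the named fact -/

/-- **The rank-`0` instance of `ArthurClozel1989_strongLifting_archimedean` holds outright**: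
for data `π` on `GL_0(𝔸_F)` and `P` on `GL_0(𝔸_E)`, if `χ` is an archimedean parameter of `π`
then `τ ↦ χ(τ|_F)` is one of `P` — with no hypothesis on `E/F` and no weak-lift hypothesis,
because both sides say that all multisets are empty (`hasArchParameter_rank_zero_iff`). This is
only the degenerate edge of the quantifier `∀ n`; the content of Arthur–Clozel's Thm. 5.1 is
`n ≥ 1`. [cite: ArthurClozelAMS120, Ch. 3 Thm. 5.1 and Ch. 1 §7] -/
theorem ArthurClozel1989_strongLifting_archimedean.rank_zero
    (F E : Type) [Field F] [NumberField F] [Field E] [NumberField E] [Algebra F E]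
    (hF : isCompact_glFiniteIntegralLevel 0 F) (hE : isCompact_glFiniteIntegralLevel 0 E)
    (π : CuspidalAutomorphicRepData 0 F hF) (P : CuspidalAutomorphicRepData 0 E hE)
    (χ : (F →+* ℂ) → Multiset ℂ) (hχ : π.1.HasArchParameter χ) :
    P.1.HasArchParameter fun τ => χ (τ.comp (algebraMap F E)) :=
  P.1.hasArchParameter_rank_zero fun _ ↦
    AutomorphicRepData.eq_zero_of_hasArchParameter_rank_zero hχ _

/-! ### Two more consequences of the fact: regular-algebraic ascent, weight zero both ways -/

namespace ArthurClozel1989_strongLifting_archimedean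

variable {n : ℕ} {F E : Type} [Field F] [NumberField F] [Field E] [NumberField E] [Algebra F E]
  [IsGalois F E] {hF : isCompact_glFiniteIntegralLevel n F}
  {hE : isCompact_glFiniteIntegralLevel n E}

/-- **Regular algebraicity ascends** along a weak base change lift: `T ↦ T^E` preserves
`C`-algebraicity and regularity (the exponents are the same numbers), and `T^E` is an infinity
type of the lift by the fact. Clozel 1990, Déf. 1.8 and 3.12.
[cite: ArthurClozelAMS120, Ch. 3 Thm. 5.1 and Ch. 1 §7] [cite: Clozel1990, Déf. 3.12] -/
theorem isRegularAlgebraic_baseChange (h : ArthurClozel1989_strongLifting_archimedean)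
    (hcyc : IsCyclic (E ≃ₐ[F] E)) (hprime : (Module.finrank F E).Prime)
    {π : CuspidalAutomorphicRepData n F hF} {P : CuspidalAutomorphicRepData n E hE}
    (hBC : IsWeakBaseChangeLiftAE π.1 P.1) (hπ : π.1.IsRegularAlgebraic) :
    P.1.IsRegularAlgebraic := by
  obtain ⟨T, hT, hC, hR⟩ := hπ
  exact ⟨T.baseChange E, h.hasInfinityType_baseChange hcyc hprime hBC hT, hC.baseChange,
    hR.baseChange⟩

/-- **Weight zero ascends**: the base change of the weight-zero infinity type of `GL_n / F` is
the weight-zero infinity type of `GL_n / E` (it is constant in the embedding), so a weak base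
change lift of a weight-zero `π` has weight zero. Clozel 1990, §3.5.
[cite: ArthurClozelAMS120, Ch. 3 Thm. 5.1 and Ch. 1 §7] [cite: Clozel1990, §3.5] -/
theorem hasWeightZero_baseChange (h : ArthurClozel1989_strongLifting_archimedean)
    (hcyc : IsCyclic (E ≃ₐ[F] E)) (hprime : (Module.finrank F E).Prime)
    {π : CuspidalAutomorphicRepData n F hF} {P : CuspidalAutomorphicRepData n E hE}
    (hBC : IsWeakBaseChangeLiftAE π.1 P.1) (hπ : π.1.HasWeightZero) : P.1.HasWeightZero :=
  h.hasInfinityType_baseChange hcyc hprime hBC hπ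

/-- **Weight zero descends** along a weak base change lift (given an infinity type `T` of `π`,
the printed `exists_hasInfinityType`): the `a`-multisets of `T` are those of the weight-zero type
of `Π` (`map_a_eq_of_comp_eq` of `BaseChangeArchimedeanDescent`), i.e. `{ρ_i}` everywhere, and
the weight-zero type of `GL_n / F` is well formed, so it is an infinity type of `π`.
Clozel 1990, §3.3 and §3.5. [cite: ArthurClozelAMS120, Ch. 3 Thm. 5.1 and Ch. 1 §7]
[cite: Clozel1990, §3.5] -/
theorem hasWeightZero_descent (h : ArthurClozel1989_strongLifting_archimedean)
    (hcyc : IsCyclic (E ≃ₐ[F] E)) (hprime : (Module.finrank F E).Prime)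
    {π : CuspidalAutomorphicRepData n F hF} {P : CuspidalAutomorphicRepData n E hE}
    (hBC : IsWeakBaseChangeLiftAE π.1 P.1) (hex : π.1.exists_hasInfinityType)
    (hP : P.1.HasWeightZero) : π.1.HasWeightZero := by
  obtain ⟨T, hT⟩ := hex
  refine ⟨isWellFormed_weightZeroInfinityType n F, ?_⟩
  have hχ : (fun σ : F →+* ℂ ↦ (weightZeroInfinityType n F σ).map ArchWeight.a) =
      fun σ ↦ (T σ).map ArchWeight.a := by
    funext σ
    obtain ⟨τ, hτ⟩ := exists_comp_algebraMap_eq (E := E) σ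
    rw [h.map_a_eq_of_comp_eq hcyc hprime hBC hT hP hτ]
    rfl
  rw [hχ]
  exact hT.2

end ArthurClozel1989_strongLifting_archimedean

end Literature.NumberTheory.Automorphic
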